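import Summits.CriticalPhenomena.SAWScalingLimit.Theorems.SAWLoopFugacityFlowIsingBoundaryRatioWindowRectDefs
import HarnessLib

/-!
# The radial-crossing LOWER bound of the rough half-annulus RSW (line `fk-anchor-transfer`, rev 11)
(crux `SAWLoopFugacityFlow.IsingBoundaryRatio`, stmt-CriticalPhenomena-10650)

A one-definition module next to `…IsingBoundaryRatioRSWMeshDefs.lean` / `…WindowRectDefs.lean` (imported, NOT
modified). The FK heart of the line (`stub_fkArmOriginForgettingPath`, Kesten–Basu–Sapozhnikov ratio scheme, blueprint
`Cruxes/IsingBoundaryRatio/Lines/fk_anchor_transfer_c3_heart_v3.md` §5–§6) needs, besides the two registered RSW clauses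
(i) "an open separating path of the lattice conformal half-annulus is likely under the FREE local measure" and (ii) "an open
radial crossing is unlikely under the WIRED local measure", the third, "hard-direction" clause

* (iii) `HalfAnnulusRadialCrossingBound` — an open RADIAL crossing `AnnCross` of the lattice conformal half-annulus
  `{ρ < |φ⁻¹| < Mρ}` at the marked prime end `a = D.pt 0` has probability `≥ c(M) > 0` under the FREE critical FK–Ising
  measure of the local graph of the annulus edges (the minimal boundary condition for this increasing event, so that the
  bound transfers to every finite supergraph and every conditioning off the annulus).

It is the gluing input of quasi-multiplicativity (Kesten 1986, Lemma (29)–(30): the open circuits of two consecutive annuli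
are joined by an open radial crossing). Unlike (i)–(ii) it needs NO boundary RSW: the crossing can be routed through the
bulk sector `{π/4 < arg φ⁻¹ < 3π/4}`, where the chart has bounded distortion uniformly in the scale (Koebe,
`Literature.Analysis.Complex.KoebeDistortion`, `HalfPlaneDistortion`) and the critical FK–Ising RSW theorem of
Duminil-Copin–Hongler–Nolin (PROVED in the tree: `Literature.Probability.LatticeModels.fkIsing_rsw_holds`) glues crossings of
a bounded chain of lattice rectangles. Nothing is asserted here; the proposition is a TARGET (stub
`stub_halfAnnulusRadialCrossingBound`).
-/

noncomputable section

open scoped Classical Topology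
open Filter Set Metric SimpleGraph
open Literature.Probability.LatticeModels Literature.Probability.RandomPlanarGeometry
open Literature.Probability.Percolation (BondConfig)
open UpperHalfPlane (upperHalfPlaneSet)

namespace Summit.CriticalPhenomena.SAWScalingLimit.Theorems.IsingBoundaryRatio

/-- **Lower bound for the radial crossing under the free local measure** (TARGET; RSW clause (iii) of the FK heart).
For the chordal chart `φ` of `(D; a, b)` and `M > 1` there is `c > 0` such that for every `ε` there is `ρ₀ > 0` with:
for every `ρ < ρ₀`, all small `δ` and every finite volume `Λ` agreeing locally with `Ω_δ` in `B(a, ε)` and containing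
every vertex of `Ω_δ` of chart radius `< Mρ`, the FREE critical FK–Ising measure of the local graph `⟨U⟩`
(`U = annEdgeFinset H Ann`, vertex type `↥Λ`, nothing wired) gives the open radial crossing `AnnCross H In Ann`
(an open walk from chart radius `≤ ρ` to chart radius `≥ Mρ` through the annulus) probability `≥ c`. Intended proof:
Koebe distortion of `φ` on the bulk sector `{π/4 ≤ arg ≤ 3π/4, ρ/2 ≤ |w| ≤ 2Mρ}` + the tree's critical FK–Ising RSW
theorem `fkIsing_rsw_holds` in a bounded chain of lattice rectangles + FKG; free measures increase with the domain.
Role: Kesten 1986, Lemma (26)–(29); input: Duminil-Copin–Hongler–Nolin 2011, Thm. 1. A TARGET of the line, not a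
cited fact; nothing is asserted. -/
def HalfAnnulusRadialCrossingBound : Prop :=
  ∀ (D : DobrushinDomain) (φ : ConformalEquiv upperHalfPlaneSet D.carrier),
    D.IsChordalUniformizing φ → ∀ (M : ℝ), 1 < M → ∃ c : ℝ, 0 < c ∧ ∀ (ε : ℝ), 0 < ε →
      ∃ ρ₀ : ℝ, 0 < ρ₀ ∧ ∀ (ρ : ℝ), 0 < ρ → ρ < ρ₀ → ∀ᶠ δ in 𝓝[>] (0 : ℝ),
        ∀ (Λ : Finset (Site 2)),
          LocalAgreement D.carrier (D.pt 0) ε δ (discreteDomainGraph D.carrier δ) Λ →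
          (∀ x ∈ meshDomain D.carrier δ, ‖φ.symm (meshPoint δ x)‖ < M * ρ → x ∈ Λ) →
            let H : SimpleGraph Λ := (discreteDomainGraph D.carrier δ).comap Subtype.val
            let In : Set Λ := annIn D φ ε δ ρ Λ
            let Ann : Set Λ := annBody D φ M ε δ ρ Λ
            c ≤ (rcMeasure (fromEdgeSet (↑(annEdgeFinset H Ann) : Set (Sym2 Λ)))
                (1 - Real.exp (-2 * criticalBetaTwo)) 2 ∅).real {ω | AnnCross H In Ann ω}

/-- `AnnCross` is increasing in the configuration (registered sub-goal of stmt-CriticalPhenomena-10650; used with FKG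
and with the comparison "free local measure ≤ any environment" to transfer clause (iii)). [folklore] -/
theorem annCross_mono : ∀ {Λ : Finset (Site 2)} (H : SimpleGraph Λ) (In Ann : Set Λ) {ω ω' : BondConfig Λ}, ω ⊆ ω' → AnnCross H In Ann ω → AnnCross H In Ann ω' := by
  intro Λ H In Ann ω ω' hsub h
  obtain ⟨a, b, p, ha, hb, hsupp, hopen⟩ := h
  exact ⟨a, b, p, ha, hb, hsupp, fun e he => hsub (hopen e he)⟩

/-- **Lower bound for the radial crossing under the free local measure of the FATTENED annulus** (TARGET; the form of
RSW clause (iii) the heart consumes, appended rev 11). As `HalfAnnulusRadialCrossingBound`, but the free critical FK–Ising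
measure is that of the local graph of the edges touching the FATTENED annulus `{ρ/2 < |φ⁻¹| < 2Mρ}`
(`annBody D φ (4M) ε δ (ρ/2)`), while the event is still the radial crossing `AnnCross` of the annulus `{ρ < |φ⁻¹| < Mρ}`;
the volume is asked to contain every vertex of chart radius `< 2Mρ`. (The free measure of the thin annulus' own edges
sees the sites of chart radius `≤ ρ` only through dangling edges, which obstructs the rectangle-chain construction at the
curved inner layer; with the fattened edge set the chain starts inside `{|φ⁻¹| < ρ}` and the radial crossing is the
sub-walk between the last visit to chart radius `≤ ρ` and the first visit to chart radius `≥ Mρ`. Downstream the bound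
is transferred to every environment by "free local measure ≤ any conditioned measure on increasing events", for which any
local edge set carrying the event will do.) Intended proof: Koebe distortion on the bulk sector + the tree's
`fkIsing_rsw_holds` in a bounded chain of lattice rectangles + FKG. A TARGET of the line; nothing is asserted. -/
def HalfAnnulusRadialCrossingBoundFat : Prop :=
  ∀ (D : DobrushinDomain) (φ : ConformalEquiv upperHalfPlaneSet D.carrier),
    D.IsChordalUniformizing φ → ∀ (M : ℝ), 1 < M → ∃ c : ℝ, 0 < c ∧ ∀ (ε : ℝ), 0 < ε →
      ∃ ρ₀ : ℝ, 0 < ρ₀ ∧ ∀ (ρ : ℝ), 0 < ρ → ρ < ρ₀ → ∀ᶠ δ in 𝓝[>] (0 : ℝ),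
        ∀ (Λ : Finset (Site 2)),
          LocalAgreement D.carrier (D.pt 0) ε δ (discreteDomainGraph D.carrier δ) Λ →
          (∀ x ∈ meshDomain D.carrier δ, ‖φ.symm (meshPoint δ x)‖ < 2 * M * ρ → x ∈ Λ) →
            let H : SimpleGraph Λ := (discreteDomainGraph D.carrier δ).comap Subtype.val
            let In : Set Λ := annIn D φ ε δ ρ Λ
            let Ann : Set Λ := annBody D φ M ε δ ρ Λ
            let AnnFat : Set Λ := annBody D φ (4 * M) ε δ (ρ / 2) Λ
            c ≤ (rcMeasure (fromEdgeSet (↑(annEdgeFinset H AnnFat) : Set (Sym2 Λ)))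
                (1 - Real.exp (-2 * criticalBetaTwo)) 2 ∅).real {ω | AnnCross H In Ann ω}

/-- The fattened annulus contains the annulus: `{ρ < r < Mρ} ⊆ {ρ/2 < r < 4M·(ρ/2)}` (registered sub-goal; the
inclusion through which the radial crossing event is carried by the fattened local edge set). [folklore] -/
theorem annBody_subset_annBody_fat : ∀ (D : DobrushinDomain) (φ : ConformalEquiv upperHalfPlaneSet D.carrier) (M ε δ ρ : ℝ) (Λ : Finset (Site 2)), 1 < M → 0 < ρ → annBody D φ M ε δ ρ Λ ⊆ annBody D φ (4 * M) ε δ (ρ / 2) Λ := by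
  intro D φ M ε δ ρ Λ hM hρ v hv
  obtain ⟨hball, hlo, hhi⟩ := hv
  refine ⟨hball, by linarith, ?_⟩
  have : M * ρ ≤ 4 * M * (ρ / 2) := by nlinarith
  exact lt_of_lt_of_le hhi this

end Summit.CriticalPhenomena.SAWScalingLimit.Theorems.IsingBoundaryRatio

end
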